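import Mathlib
import HarnessLib

/-!
# Stochastic robust approximation: sum-of-norms problems and stochastic robust least squares
(Boyd–Vandenberghe, *Convex Optimization*, §6.4.1)

Source: S. Boyd, L. Vandenberghe, *Convex Optimization*, Cambridge University Press (2004)
[cite: BoydVandenberghe2004] — open copy read, §6.4.1 "Stochastic robust approximation"
(pp. 318–319): `A = Ā + U`, `U` zero mean; (6.13) `minimize E‖Ax − b‖` "is always a convex
optimization problem"; when `prob(A = Aᵢ) = pᵢ` it is the *sum-of-norms problem*
`minimize p₁‖A₁x − b‖ + ⋯ + p_k‖A_kx − b‖`, "expressed as: minimize `pᵀt` subject to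
`‖Aᵢx − b‖ ≤ tᵢ`"; the *stochastic robust least-squares problem*:
`E‖Ax − b‖₂² = ‖Āx − b‖₂² + xᵀPx`, `P = E UᵀU`, "the form of a regularized least-squares problem
… with solution `x = (ĀᵀĀ + P)⁻¹Āᵀb`", "Jensen's inequality tells us that variation in `Ax` will
increase the average value of `‖Ax − b‖²`", and the interpretation of the Tikhonov problem (6.10)
as minimising `E‖(A + U)x − b‖²` for `U_ij` zero mean, uncorrelated, variance `δ/m`.

## Setting and relation to the tree

The finite-distribution case is written with a weight vector `p : κ → ℝ` over finitely many
scenarios; the general expectation is a Bochner integral over a probability space, with the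
integrability hypotheses stated explicitly.  Least squares is posed with linear maps between
finite-dimensional real inner product spaces (`Āᵀ` = `LinearMap.adjoint Ā`, `xᵀPx = ⟪P x, x⟫`).
The unweighted epigraph reformulation of a sum of functions is the tree's
`Literature.Analysis.Convex.SecondOrderConePrograms.sumOfFns_isMinOn_iff_epigraph` (Antoniou–Lu);
the `P = δI` problem itself (Tikhonov / ridge: existence, uniqueness, `(AᵀA + δI)⁻¹Aᵀb`) is
the tree's `Literature.Analysis.Calculus.TikhonovRegularization` (Kress) and
`Literature.LinearAlgebra.Matrix.RidgeRegression` (Golub–Van Loan) — here only the general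
`P ⪰ 0` normal equations and the stochastic interpretation (`E UᵀU = δI` for uncorrelated
entries of variance `δ/m`) are added.
-/

namespace Literature.Analysis.Convex.StochasticRobustApproximation

open Set MeasureTheory
open scoped RealInnerProductSpace BigOperators

noncomputable section

/-! ## Finite distribution: the sum-of-norms problem -/

section SumOfNorms

variable {E F : Type*} [AddCommGroup E] [Module ℝ E] [NormedAddCommGroup F] [NormedSpace ℝ F]
  {κ : Type*} [Fintype κ]

/-- `E‖Ax − b‖` when `prob(A = Aᵢ) = pᵢ`: the sum-of-norms objective `∑ pᵢ‖Aᵢx − b‖`.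
[cite: BoydVandenberghe2004, §6.4.1 (6.13)] -/
def sumOfNorms (p : κ → ℝ) (A : κ → E →ₗ[ℝ] F) (b : F) (x : E) : ℝ := ∑ i, p i * ‖A i x - b‖

/-- [folklore] `x ↦ ‖Ax − b‖` is convex. -/
private theorem convexOn_norm_residual (A : E →ₗ[ℝ] F) (b : F) :
    ConvexOn ℝ univ (fun x => ‖A x - b‖) := by
  refine ⟨convex_univ, fun x _ z _ a c ha hc hac => ?_⟩
  have : A (a • x + c • z) - b = a • (A x - b) + c • (A z - b) := by
    simp only [map_add, map_smul, smul_sub]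
    rw [← add_sub_add_comm, ← add_smul, hac, one_smul]
  show ‖A (a • x + c • z) - b‖ ≤ a • ‖A x - b‖ + c • ‖A z - b‖
  rw [this, smul_eq_mul, smul_eq_mul, ← norm_smul_of_nonneg ha, ← norm_smul_of_nonneg hc]
  exact norm_add_le _ _

/-- The stochastic robust approximation problem (finite distribution) is convex.
[cite: BoydVandenberghe2004, §6.4.1 (6.13)] -/
theorem convexOn_sumOfNorms {p : κ → ℝ} (hp : ∀ i, 0 ≤ p i) (A : κ → E →ₗ[ℝ] F) (b : F) :
    ConvexOn ℝ univ (sumOfNorms p A b) := by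
  refine ⟨convex_univ, fun x _ z _ a c ha hc hac => ?_⟩
  simp only [sumOfNorms, smul_eq_mul, Finset.mul_sum, ← Finset.sum_add_distrib]
  refine Finset.sum_le_sum fun i _ => ?_
  have h := (convexOn_norm_residual (A i) b).2 (mem_univ x) (mem_univ z) ha hc hac
  simp only [smul_eq_mul] at h
  nlinarith [hp i]

/-- For fixed residual norms `rᵢ` and weights `p ⪰ 0`: `∑ pᵢrᵢ = min {pᵀt | rᵢ ≤ tᵢ}` (attained at
`t = r`). [cite: BoydVandenberghe2004, §6.4.1] -/
theorem isLeast_weighted_epigraph {p : κ → ℝ} (hp : ∀ i, 0 ≤ p i) (r : κ → ℝ) :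
    IsLeast {s : ℝ | ∃ t : κ → ℝ, (∀ i, r i ≤ t i) ∧ s = ∑ i, p i * t i} (∑ i, p i * r i) :=
  ⟨⟨r, fun _ => le_rfl, rfl⟩, by
    rintro _ ⟨t, ht, rfl⟩
    exact Finset.sum_le_sum fun i _ => mul_le_mul_of_nonneg_left (ht i) (hp i)⟩

/-- **Sum-of-norms problem in epigraph form**: `x⋆` minimises `∑ pᵢ‖Aᵢx − b‖` iff
`(x⋆, (‖Aᵢx⋆ − b‖)ᵢ)` solves `minimize pᵀt s.t. ‖Aᵢx − b‖ ≤ tᵢ` (an SOCP for the Euclidean norm,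
an LP for `ℓ₁`/`ℓ∞`). [cite: BoydVandenberghe2004, §6.4.1] -/
theorem isMinOn_sumOfNorms_iff_epigraph {p : κ → ℝ} (hp : ∀ i, 0 ≤ p i) (A : κ → E →ₗ[ℝ] F)
    (b : F) (x₀ : E) :
    IsMinOn (sumOfNorms p A b) univ x₀ ↔
      IsMinOn (fun q : E × (κ → ℝ) => ∑ i, p i * q.2 i) {q | ∀ i, ‖A i q.1 - b‖ ≤ q.2 i}
        (x₀, fun i => ‖A i x₀ - b‖) := by
  constructor
  · intro h q hq
    exact (h (mem_univ q.1)).trans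
      ((isLeast_weighted_epigraph hp fun i => ‖A i q.1 - b‖).2 ⟨q.2, hq, rfl⟩)
  · intro h x _
    exact h (show (x, fun i => ‖A i x - b‖) ∈ {q : E × (κ → ℝ) | ∀ i, ‖A i q.1 - b‖ ≤ q.2 i}
      from fun _ => le_rfl)

end SumOfNorms

/-! ## Stochastic robust least squares: `E‖Ax − b‖₂² = ‖Āx − b‖₂² + E‖Ux‖₂²` -/

section Expectation

variable {F : Type*} [NormedAddCommGroup F] [InnerProductSpace ℝ F]

/-- **Finite distribution**: if `∑ pᵢ = 1` and the perturbation has zero mean, `∑ pᵢvᵢ = 0`, then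
`∑ pᵢ‖r + vᵢ‖² = ‖r‖² + ∑ pᵢ‖vᵢ‖²`. [cite: BoydVandenberghe2004, §6.4.1] -/
theorem sum_norm_add_sq_of_mean_zero {κ : Type*} [Fintype κ] {p : κ → ℝ} (hp1 : ∑ i, p i = 1)
    (r : F) {v : κ → F} (hv : ∑ i, p i • v i = 0) :
    ∑ i, p i * ‖r + v i‖ ^ 2 = ‖r‖ ^ 2 + ∑ i, p i * ‖v i‖ ^ 2 := by
  simp only [norm_add_sq_real, mul_add, Finset.sum_add_distrib]
  have h1 : ∑ i, p i * ‖r‖ ^ 2 = ‖r‖ ^ 2 := by rw [← Finset.sum_mul, hp1, one_mul]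
  have h2 : ∑ i, p i * (2 * ⟪r, v i⟫) = 2 * ⟪r, ∑ i, p i • v i⟫ := by
    rw [inner_sum, Finset.mul_sum]
    exact Finset.sum_congr rfl fun i _ => by rw [real_inner_smul_right]; ring
  rw [h1, h2, hv, inner_zero_right, mul_zero, add_zero]

/-- **General distribution** (Bochner expectation over a probability space): for a zero-mean
perturbation `v` with finite second moment, `E‖r + v‖² = ‖r‖² + E‖v‖²`.
[cite: BoydVandenberghe2004, §6.4.1] -/
theorem integral_norm_add_sq_of_mean_zero [CompleteSpace F] {Ω : Type*} [MeasurableSpace Ω]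
    {μ : Measure Ω} [IsProbabilityMeasure μ] (r : F) {v : Ω → F} (hv : Integrable v μ)
    (hv2 : Integrable (fun ω => ‖v ω‖ ^ 2) μ) (h0 : ∫ ω, v ω ∂μ = 0) :
    ∫ ω, ‖r + v ω‖ ^ 2 ∂μ = ‖r‖ ^ 2 + ∫ ω, ‖v ω‖ ^ 2 ∂μ := by
  simp only [norm_add_sq_real]
  have hi1 : Integrable (fun _ : Ω => ‖r‖ ^ 2) μ := integrable_const _
  have hi2 : Integrable (fun ω => 2 * ⟪r, v ω⟫) μ := (hv.const_inner r).const_mul 2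
  rw [integral_add ?_ hv2, integral_add hi1 hi2, integral_const, integral_const_mul,
    integral_inner hv, h0, inner_zero_right, mul_zero, add_zero]
  · simp
  · exact hi1.add hi2

/-- **Stochastic robust least squares, finite distribution**: with `A = Ā + Uᵢ` w.p. `pᵢ`,
`∑ pᵢ = 1`, `∑ pᵢUᵢ = 0`:  `E‖Ax − b‖² = ‖Āx − b‖² + ∑ pᵢ‖Uᵢx‖²`.
[cite: BoydVandenberghe2004, §6.4.1] -/
theorem stochasticLS_finite {E : Type*} [AddCommGroup E] [Module ℝ E] {κ : Type*} [Fintype κ]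
    {p : κ → ℝ} (hp1 : ∑ i, p i = 1) (Abar : E →ₗ[ℝ] F) {U : κ → E →ₗ[ℝ] F}
    (hU : ∑ i, p i • U i = 0) (b : F) (x : E) :
    ∑ i, p i * ‖(Abar + U i) x - b‖ ^ 2 = ‖Abar x - b‖ ^ 2 + ∑ i, p i * ‖U i x‖ ^ 2 := by
  have hv : ∑ i, p i • U i x = 0 := by
    have := congrArg (fun L : E →ₗ[ℝ] F => L x) hU
    simpa [LinearMap.sum_apply, LinearMap.smul_apply] using this
  simpa [LinearMap.add_apply, add_sub_right_comm] using
    sum_norm_add_sq_of_mean_zero hp1 (Abar x - b) hv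

/-- **Stochastic robust least squares, general distribution**: `A(ω) = Ā + U(ω)` with
`E[U(ω)x] = 0` and `E‖U(ω)x‖² < ∞`:  `E‖A(ω)x − b‖² = ‖Āx − b‖² + E‖U(ω)x‖²`.
[cite: BoydVandenberghe2004, §6.4.1] -/
theorem stochasticLS_integral [CompleteSpace F] {E : Type*} [AddCommGroup E] [Module ℝ E]
    {Ω : Type*} [MeasurableSpace Ω] {μ : Measure Ω} [IsProbabilityMeasure μ] (Abar : E →ₗ[ℝ] F)
    {U : Ω → E →ₗ[ℝ] F} (b : F) (x : E) (hU : Integrable (fun ω => U ω x) μ)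
    (hU2 : Integrable (fun ω => ‖U ω x‖ ^ 2) μ) (h0 : ∫ ω, U ω x ∂μ = 0) :
    ∫ ω, ‖(Abar + U ω) x - b‖ ^ 2 ∂μ = ‖Abar x - b‖ ^ 2 + ∫ ω, ‖U ω x‖ ^ 2 ∂μ := by
  simpa [LinearMap.add_apply, add_sub_right_comm] using
    integral_norm_add_sq_of_mean_zero (Abar x - b) hU hU2 h0

/-- **Jensen**: variation in `Ax` increases the average value of `‖Ax − b‖²`:
`‖Āx − b‖² ≤ E‖A(ω)x − b‖²`. [cite: BoydVandenberghe2004, §6.4.1] -/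
theorem normSq_mean_le_integral [CompleteSpace F] {E : Type*} [AddCommGroup E] [Module ℝ E]
    {Ω : Type*} [MeasurableSpace Ω] {μ : Measure Ω} [IsProbabilityMeasure μ] (Abar : E →ₗ[ℝ] F)
    {U : Ω → E →ₗ[ℝ] F} (b : F) (x : E) (hU : Integrable (fun ω => U ω x) μ)
    (hU2 : Integrable (fun ω => ‖U ω x‖ ^ 2) μ) (h0 : ∫ ω, U ω x ∂μ = 0) :
    ‖Abar x - b‖ ^ 2 ≤ ∫ ω, ‖(Abar + U ω) x - b‖ ^ 2 ∂μ := by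
  rw [stochasticLS_integral Abar b x hU hU2 h0]
  exact le_add_of_nonneg_right (integral_nonneg fun ω => sq_nonneg _)

end Expectation

/-! ## The regularised least-squares form `‖Āx − b‖² + xᵀPx` and its normal equations -/

section Regularized

variable {E F : Type*} [NormedAddCommGroup E] [InnerProductSpace ℝ E] [FiniteDimensional ℝ E]
  [NormedAddCommGroup F] [InnerProductSpace ℝ F] [FiniteDimensional ℝ F]

open LinearMap

/-- `P = E UᵀU` for a finite distribution: `P = ∑ pᵢ Uᵢ†Uᵢ`.
[cite: BoydVandenberghe2004, §6.4.1] -/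
def meanGram {κ : Type*} [Fintype κ] (p : κ → ℝ) (U : κ → E →ₗ[ℝ] F) : E →ₗ[ℝ] E :=
  ∑ i, p i • ((adjoint (U i)).comp (U i))

/-- `xᵀPx = E‖Ux‖²`: `⟪P x, x⟫ = ∑ pᵢ‖Uᵢx‖²`. [cite: BoydVandenberghe2004, §6.4.1] -/
theorem inner_meanGram_self {κ : Type*} [Fintype κ] (p : κ → ℝ) (U : κ → E →ₗ[ℝ] F) (x : E) :
    ⟪meanGram p U x, x⟫ = ∑ i, p i * ‖U i x‖ ^ 2 := by
  simp only [meanGram, LinearMap.sum_apply, LinearMap.smul_apply, LinearMap.comp_apply,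
    sum_inner, real_inner_smul_left, adjoint_inner_left, real_inner_self_eq_norm_sq]

/-- `P` is symmetric. [cite: BoydVandenberghe2004, §6.4.1] -/
theorem inner_meanGram_comm {κ : Type*} [Fintype κ] (p : κ → ℝ) (U : κ → E →ₗ[ℝ] F)
    (u v : E) : ⟪meanGram p U u, v⟫ = ⟪u, meanGram p U v⟫ := by
  simp only [meanGram, LinearMap.sum_apply, LinearMap.smul_apply, LinearMap.comp_apply,
    sum_inner, inner_sum, real_inner_smul_left, real_inner_smul_right, adjoint_inner_left,
    adjoint_inner_right]

/-- `P ⪰ 0` when `p ⪰ 0`. [cite: BoydVandenberghe2004, §6.4.1] -/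
theorem inner_meanGram_self_nonneg {κ : Type*} [Fintype κ] {p : κ → ℝ} (hp : ∀ i, 0 ≤ p i)
    (U : κ → E →ₗ[ℝ] F) (x : E) : 0 ≤ ⟪meanGram p U x, x⟫ := by
  rw [inner_meanGram_self]
  exact Finset.sum_nonneg fun i _ => mul_nonneg (hp i) (sq_nonneg _)

/-- The stochastic robust least-squares objective IS the regularised least-squares objective
`‖Āx − b‖² + ⟪Px, x⟫`. [cite: BoydVandenberghe2004, §6.4.1] -/
theorem stochasticLS_eq_regularized {κ : Type*} [Fintype κ] {p : κ → ℝ} (hp1 : ∑ i, p i = 1)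
    (Abar : E →ₗ[ℝ] F) {U : κ → E →ₗ[ℝ] F} (hU : ∑ i, p i • U i = 0) (b : F) (x : E) :
    ∑ i, p i * ‖(Abar + U i) x - b‖ ^ 2 = ‖Abar x - b‖ ^ 2 + ⟪meanGram p U x, x⟫ := by
  rw [stochasticLS_finite hp1 Abar hU b x, inner_meanGram_self]

/-- The regularised least-squares objective `‖Āx − b‖² + ⟪Px, x⟫`.
[cite: BoydVandenberghe2004, §6.4.1] -/
def regLSObj (Abar : E →ₗ[ℝ] F) (P : E →ₗ[ℝ] E) (b : F) (x : E) : ℝ :=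
  ‖Abar x - b‖ ^ 2 + ⟪P x, x⟫

/-- Second-order expansion of the regularised objective about `x` (for symmetric `P`): with
`g = Ā†(Āx − b) + Px`,  `f(z) = f(x) + 2⟪g, z − x⟫ + ‖Ā(z − x)‖² + ⟪P(z − x), z − x⟫`.
[cite: BoydVandenberghe2004, §6.4.1] -/
theorem regLSObj_expand (Abar : E →ₗ[ℝ] F) {P : E →ₗ[ℝ] E} (hP : ∀ u v, ⟪P u, v⟫ = ⟪u, P v⟫)
    (b : F) (x z : E) :
    regLSObj Abar P b z = regLSObj Abar P b x
      + 2 * ⟪adjoint Abar (Abar x - b) + P x, z - x⟫ + ‖Abar (z - x)‖ ^ 2 + ⟪P (z - x), z - x⟫ := by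
  have hz : z = x + (z - x) := by abel
  set d := z - x with hd
  rw [hz]
  simp only [regLSObj, map_add, inner_add_left, inner_add_right, adjoint_inner_left,
    show Abar x + Abar d - b = (Abar x - b) + Abar d by abel, norm_add_sq_real]
  have := hP d x
  rw [real_inner_comm (P x) d] at this
  linarith

/-- [folklore] A quadratic `t ↦ 2tc + t²e` (`e ≥ 0`) nonnegative for all real `t` has `c = 0`. -/
private theorem lin_coeff_eq_zero {c e : ℝ} (he : 0 ≤ e) (h : ∀ t : ℝ, 0 ≤ 2 * t * c + t ^ 2 * e) :
    c = 0 := by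
  by_contra hc
  have h1 := h (-c / (e + 1))
  rw [show 2 * (-c / (e + 1)) * c + (-c / (e + 1)) ^ 2 * e =
      -(c ^ 2 / (e + 1)) * ((e + 2) / (e + 1)) by field_simp; ring] at h1
  have : 0 < c ^ 2 / (e + 1) * ((e + 2) / (e + 1)) := by positivity
  linarith

/-- **Normal equations of the regularised problem**: for symmetric `P ⪰ 0`, `x` minimises
`‖Āx − b‖² + xᵀPx` iff `(Ā†Ā + P)x = Ā†b` ("with solution `x = (ĀᵀĀ + P)⁻¹Āᵀb`").
[cite: BoydVandenberghe2004, §6.4.1] -/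
theorem isMinOn_regLSObj_iff (Abar : E →ₗ[ℝ] F) {P : E →ₗ[ℝ] E} (hP : ∀ u v, ⟪P u, v⟫ = ⟪u, P v⟫)
    (hP0 : ∀ u, 0 ≤ ⟪P u, u⟫) (b : F) (x : E) :
    IsMinOn (regLSObj Abar P b) univ x ↔ ((adjoint Abar).comp Abar + P) x = adjoint Abar b := by
  have key : ((adjoint Abar).comp Abar + P) x = adjoint Abar b ↔
      adjoint Abar (Abar x - b) + P x = 0 := by
    rw [LinearMap.add_apply, LinearMap.comp_apply, map_sub, ← sub_eq_zero]
    constructor <;> intro h <;> (rw [← h]; abel)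
  rw [key]
  constructor
  · intro h
    set g := adjoint Abar (Abar x - b) + P x
    rw [← inner_self_eq_zero (𝕜 := ℝ)]
    refine lin_coeff_eq_zero (e := ‖Abar g‖ ^ 2 + ⟪P g, g⟫) (add_nonneg (sq_nonneg _) (hP0 g))
      fun t => ?_
    have := h (mem_univ (x + t • g))
    rw [mem_setOf_eq, regLSObj_expand Abar hP b x (x + t • g), add_sub_cancel_left, map_smul,
      map_smul, norm_smul, mul_pow, Real.norm_eq_abs, sq_abs, real_inner_smul_left,
      real_inner_smul_right, real_inner_smul_right] at this
    nlinarith [this]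
  · intro h z _
    rw [mem_setOf_eq, regLSObj_expand Abar hP b x z, h, inner_zero_left, mul_zero, add_zero]
    nlinarith [sq_nonneg ‖Abar (z - x)‖, hP0 (z - x)]

/-- A solution of the regularised normal equations minimises (the `⇐` half, no sign condition on
the data needed beyond `P ⪰ 0` symmetric). [cite: BoydVandenberghe2004, §6.4.1] -/
theorem isMinOn_regLSObj_of_eq (Abar : E →ₗ[ℝ] F) {P : E →ₗ[ℝ] E} (hP : ∀ u v, ⟪P u, v⟫ = ⟪u, P v⟫)
    (hP0 : ∀ u, 0 ≤ ⟪P u, u⟫) (b : F) {x : E}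
    (hx : ((adjoint Abar).comp Abar + P) x = adjoint Abar b) : IsMinOn (regLSObj Abar P b) univ x :=
  (isMinOn_regLSObj_iff Abar hP hP0 b x).mpr hx

/-- With `P ≻ 0` the minimiser is unique. [cite: BoydVandenberghe2004, §6.4.1] -/
theorem regLSObj_minimizer_unique (Abar : E →ₗ[ℝ] F) {P : E →ₗ[ℝ] E}
    (hP : ∀ u v, ⟪P u, v⟫ = ⟪u, P v⟫) (hPpos : ∀ u, u ≠ 0 → 0 < ⟪P u, u⟫) (b : F) {x x' : E}
    (hx : IsMinOn (regLSObj Abar P b) univ x) (hx' : IsMinOn (regLSObj Abar P b) univ x') :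
    x = x' := by
  have hP0 : ∀ u, 0 ≤ ⟪P u, u⟫ := fun u => by
    by_cases hu : u = 0
    · simp [hu]
    · exact (hPpos u hu).le
  have e1 := regLSObj_expand Abar hP b x x'
  have hg : adjoint Abar (Abar x - b) + P x = 0 := by
    have h := (isMinOn_regLSObj_iff Abar hP hP0 b x).mp hx
    rw [LinearMap.add_apply, LinearMap.comp_apply] at h
    rw [map_sub, ← h]; abel
  have hle : regLSObj Abar P b x' ≤ regLSObj Abar P b x := hx' (mem_univ x)
  rw [hg, inner_zero_left, mul_zero, add_zero] at e1
  by_contra hne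
  have hpos := hPpos (x' - x) (sub_ne_zero.mpr (Ne.symm hne))
  nlinarith [sq_nonneg ‖Abar (x' - x)‖]

end Regularized

/-! ## `E UᵀU = δI` for zero-mean uncorrelated entries of variance `δ/m` -/

section Uncorrelated

open scoped Matrix

variable {m n : Type*} [Fintype m] [Nonempty m] [Fintype n] [DecidableEq n] {Ω : Type*}
  [MeasurableSpace Ω] {μ : Measure Ω}

/-- If the entries `U_ij` (`m ≥ 1` rows) are uncorrelated with second moments
`E[U_ij U_il] = [j = l]·δ/m`, then `E‖Ux‖₂² = δ‖x‖₂²` — so the Tikhonov problem (6.10) minimises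
`E‖(A + U)x − b‖₂²` (combine with `stochasticLS_integral`).
[cite: BoydVandenberghe2004, §6.4.1 (6.10)] -/
theorem integral_normSq_mulVec_of_uncorrelated (U : Ω → Matrix m n ℝ) {δ : ℝ}
    (hint : ∀ i j l, Integrable (fun ω => U ω i j * U ω i l) μ)
    (hcov : ∀ i j l, ∫ ω, U ω i j * U ω i l ∂μ = if j = l then δ / Fintype.card m else 0)
    (x : n → ℝ) :
    ∫ ω, (U ω *ᵥ x) ⬝ᵥ (U ω *ᵥ x) ∂μ = δ * (x ⬝ᵥ x) := by
  have hexp : ∀ ω, (U ω *ᵥ x) ⬝ᵥ (U ω *ᵥ x) =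
      ∑ i, ∑ j, ∑ l, x j * x l * (U ω i j * U ω i l) := by
    intro ω
    simp only [dotProduct, Matrix.mulVec, Finset.sum_mul, Finset.mul_sum]
    exact Finset.sum_congr rfl fun i _ => Finset.sum_congr rfl fun j _ =>
      Finset.sum_congr rfl fun l _ => by ring
  simp_rw [hexp]
  rw [integral_finsetSum _ fun i _ => integrable_finsetSum _ fun j _ =>
    integrable_finsetSum _ fun l _ => (hint i j l).const_mul _]
  simp_rw [integral_finsetSum _ fun j _ => integrable_finsetSum _ fun l _ =>
    (hint _ j l).const_mul _, integral_finsetSum _ fun l _ => (hint _ _ l).const_mul _,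
    integral_const_mul, hcov, mul_ite, mul_zero, Finset.sum_ite_eq, Finset.mem_univ, if_true]
  rw [Finset.sum_const, Finset.card_univ, nsmul_eq_mul, ← Finset.sum_mul, dotProduct]
  have hm0 : (Fintype.card m : ℝ) ≠ 0 := Nat.cast_ne_zero.mpr Fintype.card_ne_zero
  field_simp

end Uncorrelated

end

end Literature.Analysis.Convex.StochasticRobustApproximation
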